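/-
Copyright (c) 2026 the pub-hodgecm-mathlib formalisation cell (harness21).  Prover seat hodgecm-mathlib-K2E3-p24 (g0), HCML Track B «K2-LIT» ∕ h413
(`stmt-HodgeConjecture-24833`), line `K2_E3_EllipticInputs`, line «SC′-IRR-lev» (leaf (S-C′-irr) `sig_K2E3GL3TwoBlockInducedIrreducible`, lead-designate K2E3-p24 (g0),
dealer D77), brick PSI-EX: **every non-archimedean local field carries a continuous non-trivial additive character `ψ : F → 𝕊`** — the standing hypothesis
`ψ.IsContinuousNontrivial` of the tree's Whittaker ∕ twisted-Jacquet ∕ Fourier files, discharged once and for all.  2026-09-04.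
-/
import Literature.NumberTheory.Automorphic.TateLocalZetaShells          -- ★ `exists_normAbs_eq_inv` (a uniformiser), `isOpen_primePowBall`; brings `primePowBall`, `AddChar.IsContinuousNontrivial` (TateLocalFactors)
import Literature.NumberTheory.Automorphic.AddCharConductorExponent     -- ★ `zero_mem_primePowBall`, `add_mem_primePowBall`, `neg_mem_primePowBall`, `mem_primePowBall_iff`
import Mathlib.Algebra.Module.CharacterModule                          -- Mathlib: `CharacterModule.exists_character_apply_ne_zero_of_ne_zero` (ℚ∕ℤ is a cogenerator)
import Mathlib.Analysis.SpecialFunctions.Complex.Circle                -- Mathlib: `AddCircle.toCircle`, `toCircle_add`, `injective_toCircle`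
import HarnessLib

/-!
# K2_E3 road (h413), line «SC′-IRR-lev», brick PSI-EX — existence of a continuous non-trivial additive character on a non-archimedean local field

Cell `pub/hodgecm-mathlib` (D-0151), Track B, seat K2E3-p24 (g0).  `--supports stmt-HodgeConjecture-24833 --as helper`; THEOREMS ONLY (no definition ∕ instance ∕ notation ∕
named fact ∕ `sorry`); never imports `Cruxes/…/Lines`.  COUNT-NEUTRAL.

WHY.  Genericity, Whittaker functionals, the twisted Jacquet functor and the (lev) rule of line «SC′-IRR-lev» (and every Fourier-analytic file of the §L line) carry a
character `ψ : AddChar F Circle` with `ψ.IsContinuousNontrivial` as a hypothesis, while the leaves ((S-C′-irr), (nsc-S-A′), …) quantify over a bare local field `F`.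
The tree had the existence of such a `ψ` only for completions of number fields (`(adeleAddChar K).adicComponent v`).  This file proves it for EVERY
non-archimedean local field, with no characteristic hypothesis and no trace to `ℚ_p`:

* **`exists_addChar_isContinuousNontrivial`** — `∃ ψ : AddChar F Circle, ψ.IsContinuousNontrivial`.

THE MATHEMATICS.  `𝒪 = 𝔭⁰` is an open additive subgroup of `F` (ultrametric), so `F ∕ 𝒪` is a (discrete) abelian group, non-zero because a uniformiser `ϖ`
(★ `exists_normAbs_eq_inv`, `‖ϖ‖ = q⁻¹`) has `‖ϖ⁻¹‖ = q > 1`, i.e. `ϖ⁻¹ ∉ 𝒪`.  Since `ℚ∕ℤ` is an injective cogenerator of abelian groups (Mathlib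
`CharacterModule.exists_character_apply_ne_zero_of_ne_zero`), there is a homomorphism `c : F ∕ 𝒪 → ℚ∕ℤ` with `c [ϖ⁻¹] ≠ 0`; composing
`F → F∕𝒪 → ℚ∕ℤ → ℝ∕ℤ → 𝕊` (the last two maps injective: `Rat.cast`, `AddCircle.toCircle`) gives an additive character `ψ` with `ψ(ϖ⁻¹) ≠ 1`, constant on the
cosets of the open subgroup `𝒪`, hence locally constant, hence continuous.  (Weil's and Tate's `ψ` are built from the trace to `ℚ_p` ∕ `𝔽_p((t))`; the
abstract divisibility argument used here is the standard proof that a totally disconnected locally compact abelian group has enough characters.)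
[WeilBNT1967, Ch. II §5 Thm. 3 p. 41] [Tate1950, §2.2 Lemma 2.2.1] [BushnellHenniart2006, §1.7 Prop.]
HONEST LABEL: HC_CM is proved only modulo the 7 printed citations (2 remaining named inputs: hLiu418 = stmt-HodgeConjecture-24832, h413 = stmt-HodgeConjecture-24833)
until rung 0 closes; count-neutral helper.

## Mathlib ∕ tree search
Tree: ★ `primePowBall`, `zero_mem_primePowBall`, `add_mem_primePowBall`, `neg_mem_primePowBall`, `isOpen_primePowBall`, `exists_normAbs_eq_inv`, `one_lt_residueFieldCard`,
`AddChar.IsContinuousNontrivial` (= `Continuous ψ ∧ ψ ≠ 0`).  Mathlib: `CharacterModule` (`= A →+ AddCircle (1:ℚ)`), `CharacterModule.exists_character_apply_ne_zero_of_ne_zero`,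
`QuotientAddGroup.mk'`, `QuotientAddGroup.eq_zero_iff`, `QuotientAddGroup.map`, `AddCircle.toCircle`, `AddCircle.toCircle_add`, `AddCircle.toCircle_zero`,
`AddCircle.injective_toCircle`, `IsLocallyConstant.continuous`, `IsLocallyConstant.iff_exists_open`.
Dedup: `lean search '∃ ψ : AddChar . Circle, .*IsContinuousNontrivial|exists_addChar_isContinuousNontrivial|exists_isContinuousNontrivial'` — no existence theorem in
Mathlib ∕ Literature ∕ Summits (only hypotheses and the adelic components `AdeleAddCharLocalNontrivial`).

## References
* [WeilBNT1967] A. Weil, *Basic Number Theory* (1967), Ch. II §5, Thm. 3.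
* [Tate1950] J. Tate, *Fourier analysis in number fields and Hecke's zeta-functions* (1950), §2.2.
* [BushnellHenniart2006] C. J. Bushnell, G. Henniart, *The local Langlands conjecture for GL(2)* (2006), §1.7.
-/

set_option autoImplicit false
set_option linter.dupNamespace false

noncomputable section

open Topology Set
open scoped NNReal
open Literature.NumberTheory.GaloisRepresentations Literature.NumberTheory.GaloisRepresentations.IsNonarchimedeanLocalField
open Literature.NumberTheory.Automorphic

namespace Summit.HodgeConjecture.HodgeConjecture.Cruxes.H413.K2E3LocalFieldAddCharExists

variable {F : Type*} [Field F] [ValuativeRel F] [TopologicalSpace F] [IsNonarchimedeanLocalField F]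

/-! ## §1  The discrete group `F ∕ 𝒪` and its characters -/

/-- `ℚ∕ℤ → ℝ∕ℤ`, the map of `AddCircle`s induced by `Rat.cast`. [folklore] -/
theorem zmultiples_le_comap_zmultiples :
    AddSubgroup.zmultiples (1 : ℚ) ≤ (AddSubgroup.zmultiples (1 : ℝ)).comap ((Rat.castHom ℝ : ℚ →+* ℝ) : ℚ →+ ℝ) := by
  intro x hx
  obtain ⟨k, rfl⟩ := AddSubgroup.mem_zmultiples_iff.1 hx
  rw [AddSubgroup.mem_comap]
  refine AddSubgroup.mem_zmultiples_iff.2 ⟨k, ?_⟩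
  simp

/-- **`ℚ∕ℤ → ℝ∕ℤ` is injective** (a rational which is an integer in `ℝ` is an integer in `ℚ`). [folklore] -/
theorem injective_ratCircleToRealCircle :
    Function.Injective (QuotientAddGroup.map (AddSubgroup.zmultiples (1 : ℚ)) (AddSubgroup.zmultiples (1 : ℝ))
      ((Rat.castHom ℝ : ℚ →+* ℝ) : ℚ →+ ℝ) zmultiples_le_comap_zmultiples) := by
  rw [injective_iff_map_eq_zero]
  intro x hx
  induction x using QuotientAddGroup.induction_on with
  | H q =>
    rw [QuotientAddGroup.map_mk, QuotientAddGroup.eq_zero_iff] at hx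
    rw [QuotientAddGroup.eq_zero_iff]
    obtain ⟨k, hk⟩ := AddSubgroup.mem_zmultiples_iff.1 hx
    refine AddSubgroup.mem_zmultiples_iff.2 ⟨k, ?_⟩
    have hk' : ((k : ℚ) : ℝ) = ((q : ℚ) : ℝ) := by
      simpa using hk
    rw [Int.smul_one_eq_cast]
    exact_mod_cast hk'

/-! ## §2  The character -/

/-- **EXISTENCE OF A CONTINUOUS NON-TRIVIAL ADDITIVE CHARACTER** on a non-archimedean local field `F`: there is `ψ : F → 𝕊`, additive, continuous and `≠ 1`
(indeed trivial on `𝒪` and `ψ(ϖ⁻¹) ≠ 1` for a uniformiser `ϖ`).  Proof: `F∕𝒪` is a non-zero abelian group, `ℚ∕ℤ` is a cogenerator, and `ℚ∕ℤ ↪ ℝ∕ℤ ↪ 𝕊`;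
a character trivial on the open subgroup `𝒪` is locally constant. [cite: WeilBNT1967, Ch. II §5 Thm. 3] [cite: Tate1950, §2.2] [cite: BushnellHenniart2006, §1.7] -/
theorem exists_addChar_isContinuousNontrivial (F : Type*) [Field F] [ValuativeRel F] [TopologicalSpace F] [IsNonarchimedeanLocalField F] :
    ∃ ψ : AddChar F Circle, ψ.IsContinuousNontrivial := by
  classical
  -- the open additive subgroup `𝒪 = 𝔭⁰`
  let O : AddSubgroup F :=
    { carrier := primePowBall F 0
      add_mem' := fun hx hy => add_mem_primePowBall hx hy
      zero_mem' := zero_mem_primePowBall 0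
      neg_mem' := fun hx => neg_mem_primePowBall hx }
  have hOo : IsOpen (O : Set F) := isOpen_primePowBall (F := F) 0
  -- a vector outside `𝒪`: the inverse of a uniformiser
  obtain ⟨ϖ, hϖ0, hϖ⟩ := exists_normAbs_eq_inv (F := F)
  have hq1 : (1 : ℝ≥0) < residueFieldCard F := by exact_mod_cast one_lt_residueFieldCard F
  have hx₀ : ϖ⁻¹ ∉ O := by
    intro h
    have h' : normAbs F ϖ⁻¹ ≤ (residueFieldCard F : ℝ≥0)⁻¹ ^ (0 : ℤ) := h
    rw [zpow_zero, map_inv₀, hϖ, inv_inv] at h'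
    exact not_lt.2 h' hq1
  -- a character of `F ∕ 𝒪` not vanishing at `[ϖ⁻¹]`
  have hne : (QuotientAddGroup.mk (ϖ⁻¹) : F ⧸ O) ≠ 0 := by
    rwa [ne_eq, QuotientAddGroup.eq_zero_iff]
  obtain ⟨c, hc⟩ := CharacterModule.exists_character_apply_ne_zero_of_ne_zero hne
  -- `F → F∕𝒪 → ℚ∕ℤ → ℝ∕ℤ`
  let ι : AddCircle (1 : ℚ) →+ AddCircle (1 : ℝ) :=
    QuotientAddGroup.map (AddSubgroup.zmultiples (1 : ℚ)) (AddSubgroup.zmultiples (1 : ℝ)) ((Rat.castHom ℝ : ℚ →+* ℝ) : ℚ →+ ℝ)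
      zmultiples_le_comap_zmultiples
  let φ : F →+ AddCircle (1 : ℝ) := ι.comp ((c : (F ⧸ O) →+ AddCircle (1 : ℚ)).comp (QuotientAddGroup.mk' O))
  have hφO : ∀ a ∈ O, φ a = 0 := by
    intro a ha
    simp only [φ, AddMonoidHom.coe_comp, Function.comp_apply, QuotientAddGroup.coe_mk', (QuotientAddGroup.eq_zero_iff a).2 ha, map_zero]
  -- the character
  let ψ : AddChar F Circle :=
    { toFun := fun x => AddCircle.toCircle (φ x)
      map_zero_eq_one' := by simp only [map_zero, AddCircle.toCircle_zero]
      map_add_eq_mul' := fun x y => by simp only [map_add, AddCircle.toCircle_add] }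
  have hψapp : ∀ x, ψ x = AddCircle.toCircle (φ x) := fun _ => rfl
  refine ⟨ψ, ?_, ?_⟩
  · -- continuity: `ψ` is constant on the cosets of the open subgroup `𝒪`
    refine IsLocallyConstant.continuous ((IsLocallyConstant.iff_exists_open ψ).2 fun x => ?_)
    refine ⟨(fun a => x + a) '' (O : Set F), (isOpenMap_add_left x) _ hOo, ⟨0, O.zero_mem, add_zero x⟩, ?_⟩
    rintro _ ⟨a, ha, rfl⟩
    rw [hψapp, hψapp, map_add, hφO a ha, add_zero]
  · -- non-triviality: `ψ(ϖ⁻¹) ≠ 1`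
    intro h
    have h1 : ψ ϖ⁻¹ = 1 := by rw [h]; rfl
    rw [hψapp, ← AddCircle.toCircle_zero] at h1
    have h2 : ι (c (QuotientAddGroup.mk' O ϖ⁻¹)) = 0 := AddCircle.injective_toCircle one_ne_zero h1
    exact hc (injective_ratCircleToRealCircle (h2.trans (map_zero ι).symm))

end Summit.HodgeConjecture.HodgeConjecture.Cruxes.H413.K2E3LocalFieldAddCharExists

end
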